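import Mathlib
import Literature.NumberTheory.Transcendental.EllIterRep
import Literature.NumberTheory.Transcendental.KZLogCalculusProofs
import Summits.KontsevichZagierPeriods.KontsevichZagierPeriods.Theorems.UnfoldedStokesLegendreCubicFormStubJacobian

/-!
# `KummerFamily` (item stmt-KontsevichZagierPeriods-6780, route GenusOneIterated) — one-variable
algebra and calculus of the reflection certificate

For a real cubic `E : y² = f(x) = 4(x − e₁)(x − e₂)(x − e₃)` with real algebraic roots
`e₃ < e₂ < e₁` (`KZ.EllCurve`) the length-two iterated integral
`I(ωη) − I(ηω) = ∫∫_{e₃<x₀<x₁<e₂} (x₁ − x₀)/(√f(x₀)√f(x₁))` is a Kummer logarithm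
`½ log((e₁ − e₃)/(e₁ − e₂)) = ∫_{e₁−e₂}^{e₁−e₃} du/(2u)`, and the route item asks for a
KZ-equivalence of the two representations. This file records the one-variable ingredients of the
move certificate, all with the maps written out explicitly (no new definitions):

* the reflection `σ(x) = e₁ + A/(x − e₁)`, `A = (e₁ − e₂)(e₁ − e₃)` — the abscissa of `P₁ − P`,
  `P₁ = (e₁, 0)` the third `2`-torsion point: an involution of the oval range `(e₃, e₂)` reversing
  the order, with `f(σ x) = σ′(x)² f(x)` (`σ′(x) = −A/(x − e₁)²`), so that `σ^*(dx/√f) = −dx/√f`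
  (`sigma_sigma`, `sigma_mem`, `sigma_lt_sigma`, `f_sigma`);
* the algebraic primitive `φ(x) = √f(x)/(2(e₁ − x))` with `φ′(x) = (σ(x) − x)/√f(x)` on `(e₃, e₂)`
  (`hasDerivAt_phi`: the exact form `η′ − η = dφ·(…)` of the planner's certificate), `φ(e₂) = 0`,
  `φ/√f = 1/(2(e₁ − x))`;
* `ℚ`-semialgebraicity of the functions `x ↦ σ(x_k)`, `σ′(x_k)`, `1/√f(x_k)`, `φ(x_k)` on
  `ℚ`-semialgebraic sets (real algebraic constants are `ℚ`-definable; closure under `+,·,/,√` from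
  Tarski–Seidenberg, all proved in the tree);
* the determinant of the Jacobian of the reflection move on `ℝ²` (via `det_pi_fin_two` of
  Theorems/UnfoldedStokesLegendreCubicFormStubJacobian).

References: Kontsevich–Zagier, *Periods* (2001), §1.2; Whittaker–Watson (1927), §20.33 (addition
of a half-period); Lawden (1989), §6.12.
-/

noncomputable section

open Set MeasureTheory
open Literature.NumberTheory.Transcendental Literature.ModelTheory.ExponentialFields

namespace Summit.KontsevichZagierPeriods.GenusOneIterated.KummerFamily

variable (E : KZ.EllCurve)

/-! ### The reflection `σ(x) = e₁ + A/(x − e₁)` -/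

/-- `A = (e₁ − e₂)(e₁ − e₃) > 0`. [folklore] -/
theorem A_pos : 0 < (E.e₁ - E.e₂) * (E.e₁ - E.e₃) :=
  mul_pos (sub_pos.2 E.e₂_lt_e₁) (sub_pos.2 (E.e₃_lt_e₂.trans E.e₂_lt_e₁))

/-- `A` is a real algebraic number. [folklore] -/
theorem isAlgebraic_A : IsAlgebraic ℚ ((E.e₁ - E.e₂) * (E.e₁ - E.e₃)) :=
  (E.isAlgebraic_e₁.sub E.isAlgebraic_e₂).mul (E.isAlgebraic_e₁.sub E.isAlgebraic_e₃)

/-- `σ(x) − e₃ = (e₁ − e₃)(x − e₂)/(x − e₁)`. [folklore] -/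
theorem sigma_sub_e₃ {x : ℝ} (hx : x ≠ E.e₁) :
    E.e₁ + (E.e₁ - E.e₂) * (E.e₁ - E.e₃) / (x - E.e₁) - E.e₃ =
      (E.e₁ - E.e₃) * (x - E.e₂) / (x - E.e₁) := by
  have h : x - E.e₁ ≠ 0 := sub_ne_zero.2 hx
  field_simp
  ring

/-- `σ(x) − e₂ = (e₁ − e₂)(x − e₃)/(x − e₁)`. [folklore] -/
theorem sigma_sub_e₂ {x : ℝ} (hx : x ≠ E.e₁) :
    E.e₁ + (E.e₁ - E.e₂) * (E.e₁ - E.e₃) / (x - E.e₁) - E.e₂ =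
      (E.e₁ - E.e₂) * (x - E.e₃) / (x - E.e₁) := by
  have h : x - E.e₁ ≠ 0 := sub_ne_zero.2 hx
  field_simp
  ring

/-- `σ` maps the oval range `(e₃, e₂)` into itself. [folklore] -/
theorem sigma_mem {x : ℝ} (h₃ : E.e₃ < x) (h₂ : x < E.e₂) :
    E.e₃ < E.e₁ + (E.e₁ - E.e₂) * (E.e₁ - E.e₃) / (x - E.e₁) ∧
      E.e₁ + (E.e₁ - E.e₂) * (E.e₁ - E.e₃) / (x - E.e₁) < E.e₂ := by
  have h₁ : x < E.e₁ := h₂.trans E.e₂_lt_e₁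
  have hx1 : x - E.e₁ < 0 := sub_neg.2 h₁
  constructor
  · have h := sigma_sub_e₃ E h₁.ne
    have hpos : 0 < (E.e₁ - E.e₃) * (x - E.e₂) / (x - E.e₁) :=
      div_pos_of_neg_of_neg (mul_neg_of_pos_of_neg (sub_pos.2 (E.e₃_lt_e₂.trans E.e₂_lt_e₁))
        (sub_neg.2 h₂)) hx1
    linarith
  · have h := sigma_sub_e₂ E h₁.ne
    have hneg : (E.e₁ - E.e₂) * (x - E.e₃) / (x - E.e₁) < 0 :=
      div_neg_of_pos_of_neg (mul_pos (sub_pos.2 E.e₂_lt_e₁) (sub_pos.2 h₃)) hx1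
    linarith

/-- `σ` is an involution off the pole: `σ(σ(x)) = x` for `x ≠ e₁`. [folklore] -/
theorem sigma_sigma {x : ℝ} (hx : x ≠ E.e₁) :
    E.e₁ + (E.e₁ - E.e₂) * (E.e₁ - E.e₃) /
        (E.e₁ + (E.e₁ - E.e₂) * (E.e₁ - E.e₃) / (x - E.e₁) - E.e₁) = x := by
  have hA : (E.e₁ - E.e₂) * (E.e₁ - E.e₃) ≠ 0 := (A_pos E).ne'
  have h1 : x - E.e₁ ≠ 0 := sub_ne_zero.2 hx
  have h2 : E.e₁ + (E.e₁ - E.e₂) * (E.e₁ - E.e₃) / (x - E.e₁) - E.e₁ =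
      (E.e₁ - E.e₂) * (E.e₁ - E.e₃) / (x - E.e₁) := by ring
  rw [h2, div_div_eq_mul_div, mul_comm, mul_div_assoc, div_self hA, mul_one]
  ring

/-- `σ(σ(x)) = x`, with the inner difference `σ(x) − e₁ = A/(x − e₁)` already simplified (the
`simp`-normal form). [folklore] -/
theorem sigma_sigma' (x : ℝ) :
    E.e₁ + (E.e₁ - E.e₂) * (E.e₁ - E.e₃) / ((E.e₁ - E.e₂) * (E.e₁ - E.e₃) / (x - E.e₁)) = x := by
  have hA : (E.e₁ - E.e₂) * (E.e₁ - E.e₃) ≠ 0 := (A_pos E).ne'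
  rw [div_div_eq_mul_div, mul_comm, mul_div_assoc, div_self hA, mul_one]
  ring

/-- `σ` is strictly decreasing to the left of the pole `e₁`. [folklore] -/
theorem sigma_lt_sigma {x y : ℝ} (hx : x < E.e₁) (hy : y < E.e₁) (hxy : x < y) :
    E.e₁ + (E.e₁ - E.e₂) * (E.e₁ - E.e₃) / (y - E.e₁) <
      E.e₁ + (E.e₁ - E.e₂) * (E.e₁ - E.e₃) / (x - E.e₁) := by
  have h1 : x - E.e₁ < 0 := sub_neg.2 hx
  have h2 : y - E.e₁ < 0 := sub_neg.2 hy
  have h : E.e₁ + (E.e₁ - E.e₂) * (E.e₁ - E.e₃) / (x - E.e₁) -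
      (E.e₁ + (E.e₁ - E.e₂) * (E.e₁ - E.e₃) / (y - E.e₁)) =
      (E.e₁ - E.e₂) * (E.e₁ - E.e₃) * (y - x) / ((x - E.e₁) * (y - E.e₁)) := by
    have h1' : x - E.e₁ ≠ 0 := h1.ne
    have h2' : y - E.e₁ ≠ 0 := h2.ne
    field_simp
    ring
  have hpos : 0 < (E.e₁ - E.e₂) * (E.e₁ - E.e₃) * (y - x) / ((x - E.e₁) * (y - E.e₁)) :=
    div_pos (mul_pos (A_pos E) (sub_pos.2 hxy)) (mul_pos_of_neg_of_neg h1 h2)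
  linarith

/-- **Invariance of `dx/y`**: `f(σ x) = σ′(x)² · f(x)`, `σ′(x) = −A/(x − e₁)²`
(Whittaker–Watson §20.33, differentiated). [folklore] -/
theorem f_sigma {x : ℝ} (hx : x ≠ E.e₁) :
    E.f (E.e₁ + (E.e₁ - E.e₂) * (E.e₁ - E.e₃) / (x - E.e₁)) =
      (-((E.e₁ - E.e₂) * (E.e₁ - E.e₃)) / (x - E.e₁) ^ 2) ^ 2 * E.f x := by
  -- adapted from `RealEllipticSectorKernel.twoTorsion_cubic`
  -- (Theorems/HermiteRigidityRealEllipticSectorKernelStubTwoTorsion)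
  have h : x - E.e₁ ≠ 0 := sub_ne_zero.2 hx
  simp only [KZ.EllCurve.f]
  field_simp
  ring

/-- The derivative of `σ`: `σ′(x) = −A/(x − e₁)²` off the pole. [folklore] -/
theorem hasDerivAt_sigma {x : ℝ} (hx : x ≠ E.e₁) :
    HasDerivAt (fun y : ℝ => E.e₁ + (E.e₁ - E.e₂) * (E.e₁ - E.e₃) / (y - E.e₁))
      (-((E.e₁ - E.e₂) * (E.e₁ - E.e₃)) / (x - E.e₁) ^ 2) x := by
  -- adapted from `RealEllipticSectorKernel.twoTorsion_hasFDerivAt`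
  have h0 : x - E.e₁ ≠ 0 := sub_ne_zero.2 hx
  have h1 : HasDerivAt (fun y : ℝ => y - E.e₁) 1 x := (hasDerivAt_id x).sub_const E.e₁
  have h2 : HasDerivAt (fun y : ℝ => (y - E.e₁)⁻¹) (-(1 : ℝ) / (x - E.e₁) ^ 2) x := h1.inv h0
  have h3 := (h2.const_mul ((E.e₁ - E.e₂) * (E.e₁ - E.e₃))).const_add E.e₁
  have h4 : (fun y : ℝ => E.e₁ + (E.e₁ - E.e₂) * (E.e₁ - E.e₃) / (y - E.e₁)) =
      fun y => E.e₁ + (E.e₁ - E.e₂) * (E.e₁ - E.e₃) * (y - E.e₁)⁻¹ := by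
    funext y
    rw [div_eq_mul_inv]
  rw [h4]
  exact h3.congr_deriv (by ring)

/-! ### The primitive `φ(x) = √f(x)/(2(e₁ − x))` -/

/-- `f(e₂) = 0`. [folklore] -/
theorem f_e₂ : E.f E.e₂ = 0 := by
  simp [KZ.EllCurve.f]

/-- `φ(e₂) = 0`. [folklore] -/
theorem phi_e₂ : √(E.f E.e₂) / (2 * (E.e₁ - E.e₂)) = 0 := by
  rw [f_e₂, Real.sqrt_zero, zero_div]

/-- `φ(x) · (1/√f(x)) = 1/(2(e₁ − x))` on `(e₃, e₂)`. [folklore] -/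
theorem phi_mul_inv_sqrt {x : ℝ} (h₃ : E.e₃ < x) (h₂ : x < E.e₂) :
    √(E.f x) / (2 * (E.e₁ - x)) * (1 / √(E.f x)) = 1 / (2 * (E.e₁ - x)) := by
  have hs : √(E.f x) ≠ 0 := (Real.sqrt_pos.2 (E.f_pos h₃ h₂)).ne'
  have h1 : 2 * (E.e₁ - x) ≠ 0 := mul_ne_zero two_ne_zero (sub_ne_zero.2 (h₂.trans E.e₂_lt_e₁).ne')
  field_simp

/-- `φ` is continuous on `(−∞, e₂]` (the denominator vanishes only at `e₁ > e₂`). [folklore] -/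
theorem continuousOn_phi : ContinuousOn (fun u : ℝ => √(E.f u) / (2 * (E.e₁ - u))) (Iic E.e₂) := by
  refine ContinuousOn.div (E.continuous_f.sqrt.continuousOn) (by fun_prop) fun u hu => ?_
  have hu : u ≤ E.e₂ := hu
  exact mul_ne_zero two_ne_zero (sub_ne_zero.2 (hu.trans_lt E.e₂_lt_e₁).ne')

/-- The derivative of the cubic `f`. [folklore] -/
theorem hasDerivAt_f (t : ℝ) :
    HasDerivAt E.f (4 * ((t - E.e₂) * (t - E.e₃) + (t - E.e₁) * (t - E.e₃) +
      (t - E.e₁) * (t - E.e₂))) t := by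
  have h1 : HasDerivAt (fun x : ℝ => 4 * (x - E.e₁)) 4 t := by
    simpa using ((hasDerivAt_id t).sub_const E.e₁).const_mul 4
  have h2 : HasDerivAt (fun x : ℝ => x - E.e₂) 1 t := (hasDerivAt_id t).sub_const E.e₂
  have h3 : HasDerivAt (fun x : ℝ => x - E.e₃) 1 t := (hasDerivAt_id t).sub_const E.e₃
  have h := (h1.mul h2).mul h3
  have hf : E.f = ((fun x : ℝ => 4 * (x - E.e₁)) * fun x => x - E.e₂) * fun x => x - E.e₃ := by
    funext x
    simp only [KZ.EllCurve.f, Pi.mul_apply]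
  rw [hf]
  refine h.congr_deriv ?_
  simp only [Pi.mul_apply]
  ring

/-- **The exact form**: `φ′(t) = (σ(t) − t)/√f(t)` on `(e₃, e₂)`, i.e.
`(σ(x) − x) dx/y = d(√f/(2(e₁ − x)))` — the identity
`(σ(x) − x)(x − e₁) = A − (x − e₁)² = −[f′(x)(x − e₁) − 2f(x)]/(4(x − e₁))` of the route text.
[folklore] -/
theorem hasDerivAt_phi {t : ℝ} (h₃ : E.e₃ < t) (h₂ : t < E.e₂) :
    HasDerivAt (fun u : ℝ => √(E.f u) / (2 * (E.e₁ - u)))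
      ((E.e₁ + (E.e₁ - E.e₂) * (E.e₁ - E.e₃) / (t - E.e₁) - t) / √(E.f t)) t := by
  have h₁ : t < E.e₁ := h₂.trans E.e₂_lt_e₁
  have hft : 0 < E.f t := E.f_pos h₃ h₂
  have hy : 0 < √(E.f t) := Real.sqrt_pos.2 hft
  have hsq := (hasDerivAt_f E t).sqrt hft.ne'
  have hden : HasDerivAt (fun u : ℝ => 2 * (E.e₁ - u)) (2 * (-1)) t :=
    ((hasDerivAt_id t).const_sub E.e₁).const_mul 2 |>.congr_deriv (by simp)
  have hne : 2 * (E.e₁ - t) ≠ 0 := mul_ne_zero two_ne_zero (sub_ne_zero.2 h₁.ne')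
  have h := hsq.div hden hne
  refine h.congr_deriv ?_
  have hy2 : √(E.f t) ^ 2 = E.f t := Real.sq_sqrt hft.le
  have ht1 : t - E.e₁ ≠ 0 := sub_ne_zero.2 h₁.ne
  have ht1' : E.e₁ - t ≠ 0 := sub_ne_zero.2 h₁.ne'
  rw [div_eq_div_iff (pow_ne_zero 2 hne) hy.ne']
  have key : E.f t = 4 * (t - E.e₁) * (t - E.e₂) * (t - E.e₃) := rfl
  field_simp
  rw [hy2, key]
  ring

/-! ### `ℚ`-semialgebraicity of the ingredients -/

section Semialgebraic

variable {n : ℕ} {s : Set (Fin n → ℝ)}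

/-- The coordinate function `x ↦ x k` is `ℚ`-semialgebraic. [folklore] -/
theorem isSemialgebraicFunOn_coord (hs : IsSemialgebraic ℚ s) (k : Fin n) :
    IsSemialgebraicFunOn ℚ s (fun x => x k) :=
  (isSemialgebraicFunOn_aeval hs (MvPolynomial.X k)).congr fun x _ => by simp

/-- `1/h` is `ℚ`-semialgebraic for `ℚ`-semialgebraic `h`, with Lean's junk value `1/0 = 0`
(glue `{h ≠ 0}` and `{h = 0}`). [folklore] -/
theorem isSemialgebraicFunOn_one_div {h : (Fin n → ℝ) → ℝ} (hh : IsSemialgebraicFunOn ℚ s h) :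
    IsSemialgebraicFunOn ℚ s (fun x => 1 / h x) := by
  have hs : IsSemialgebraic ℚ s := IsSemialgebraicFunOn.isSemialgebraic_holds hh
  have hneg : IsSemialgebraic ℚ {x | x ∈ s ∧ h x < 0} := hh.isSemialgebraic_sep_neg
  have hpos : IsSemialgebraic ℚ {x | x ∈ s ∧ (-h) x < 0} := hh.neg.isSemialgebraic_sep_neg
  have hne : IsSemialgebraic ℚ ({x | x ∈ s ∧ h x < 0} ∪ {x | x ∈ s ∧ (-h) x < 0}) :=
    hneg.union hpos
  have hze : IsSemialgebraic ℚ (s \ ({x | x ∈ s ∧ h x < 0} ∪ {x | x ∈ s ∧ (-h) x < 0})) :=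
    hs.diff hne
  have hne0 : ∀ x ∈ {x | x ∈ s ∧ h x < 0} ∪ {x | x ∈ s ∧ (-h) x < 0}, h x ≠ 0 := by
    rintro x (⟨-, hx⟩ | ⟨-, hx⟩)
    · exact hx.ne
    · simp only [Pi.neg_apply, neg_lt_zero] at hx
      exact hx.ne'
  have h1 : IsSemialgebraicFunOn ℚ ({x | x ∈ s ∧ h x < 0} ∪ {x | x ∈ s ∧ (-h) x < 0})
      (fun x => 1 / h x) :=
    ((hh.mono (by rintro x (⟨hx, -⟩ | ⟨hx, -⟩) <;> exact hx) hne).inv hne0).congr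
      fun x _ => by simp
  have h2 : IsSemialgebraicFunOn ℚ (s \ ({x | x ∈ s ∧ h x < 0} ∪ {x | x ∈ s ∧ (-h) x < 0}))
      (fun _ => (0 : ℝ)) := by
    simpa using isSemialgebraicFunOn_natCast (k := ℚ) (R := ℝ) hze 0
  have hu := IsSemialgebraicFunOn.union h1 h2 (F := fun x => 1 / h x) (fun x _ => rfl)
    (fun x hx => by
      obtain ⟨hxs, hx⟩ := hx
      simp only [mem_union, mem_setOf_eq, Pi.neg_apply, neg_lt_zero, not_or, not_and, not_lt]
        at hx
      have h0 : h x = 0 := le_antisymm (hx.2 hxs) (hx.1 hxs)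
      simp [h0])
  have hsub : {x | x ∈ s ∧ h x < 0} ∪ {x | x ∈ s ∧ (-h) x < 0} ⊆ s := by
    rintro x (⟨hx, -⟩ | ⟨hx, -⟩) <;> exact hx
  rwa [union_sdiff_self, union_eq_self_of_subset_left hsub] at hu

/-- `x ↦ 1/√f(x_k)` is `ℚ`-semialgebraic on any `ℚ`-semialgebraic set (junk value `0` where
`f(x_k) ≤ 0`). [folklore] -/
theorem isSemialgebraicFunOn_inv_sqrt_f_apply (hs : IsSemialgebraic ℚ s) (k : Fin n) :
    IsSemialgebraicFunOn ℚ s (fun x => 1 / √(E.f (x k))) :=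
  isSemialgebraicFunOn_one_div (IsSemialgebraicFunOn.sqrt_holds (KZ.isSemialgebraicFunOn_f_apply hs E k))

/-- `x ↦ σ(x_k)` is `ℚ`-semialgebraic on any `ℚ`-semialgebraic set off the pole `x_k = e₁`.
[folklore] -/
theorem isSemialgebraicFunOn_sigma_apply (hs : IsSemialgebraic ℚ s) (k : Fin n)
    (hk : ∀ x ∈ s, x k ≠ E.e₁) :
    IsSemialgebraicFunOn ℚ s
      (fun x => E.e₁ + (E.e₁ - E.e₂) * (E.e₁ - E.e₃) / (x k - E.e₁)) := by
  -- adapted from `RealEllipticSectorKernel.twoTorsion_isSemialgebraicFunOn`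
  have he₁ : IsSemialgebraicFunOn ℚ s (fun _ => E.e₁) :=
    isSemialgebraicFunOn_const_of_isAlgebraic hs E.isAlgebraic_e₁
  have hA : IsSemialgebraicFunOn ℚ s (fun _ => (E.e₁ - E.e₂) * (E.e₁ - E.e₃)) :=
    isSemialgebraicFunOn_const_of_isAlgebraic hs (isAlgebraic_A E)
  have hden : IsSemialgebraicFunOn ℚ s (fun x => x k - E.e₁) :=
    IsSemialgebraicFunOn.sub_holds (isSemialgebraicFunOn_coord hs k) he₁
  have hne : ∀ x ∈ s, x k - E.e₁ ≠ 0 := fun x hx => sub_ne_zero.2 (hk x hx)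
  exact (IsSemialgebraicFunOn.add_holds he₁ (hA.div hden hne)).congr fun x _ => rfl

/-- `x ↦ σ′(x_k) = −A/(x_k − e₁)²` is `ℚ`-semialgebraic off the pole. [folklore] -/
theorem isSemialgebraicFunOn_dsigma_apply (hs : IsSemialgebraic ℚ s) (k : Fin n)
    (hk : ∀ x ∈ s, x k ≠ E.e₁) :
    IsSemialgebraicFunOn ℚ s
      (fun x => -((E.e₁ - E.e₂) * (E.e₁ - E.e₃)) / (x k - E.e₁) ^ 2) := by
  have hA : IsSemialgebraicFunOn ℚ s (fun _ => -((E.e₁ - E.e₂) * (E.e₁ - E.e₃))) :=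
    isSemialgebraicFunOn_const_of_isAlgebraic hs (isAlgebraic_A E).neg
  have hden : IsSemialgebraicFunOn ℚ s (fun x => x k - E.e₁) :=
    IsSemialgebraicFunOn.sub_holds (isSemialgebraicFunOn_coord hs k)
      (isSemialgebraicFunOn_const_of_isAlgebraic hs E.isAlgebraic_e₁)
  have hden2 : IsSemialgebraicFunOn ℚ s (fun x => (x k - E.e₁) ^ 2) :=
    (IsSemialgebraicFunOn.mul_holds hden hden).congr fun x _ => by simp [sq]
  have hne : ∀ x ∈ s, (x k - E.e₁) ^ 2 ≠ 0 := fun x hx => pow_ne_zero 2 (sub_ne_zero.2 (hk x hx))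
  exact (hA.div hden2 hne).congr fun x _ => rfl

/-- `x ↦ φ(x_k) = √f(x_k)/(2(e₁ − x_k))` is `ℚ`-semialgebraic off `x_k = e₁`. [folklore] -/
theorem isSemialgebraicFunOn_phi_apply (hs : IsSemialgebraic ℚ s) (k : Fin n)
    (hk : ∀ x ∈ s, x k ≠ E.e₁) :
    IsSemialgebraicFunOn ℚ s (fun x => √(E.f (x k)) / (2 * (E.e₁ - x k))) := by
  have hnum := IsSemialgebraicFunOn.sqrt_holds (KZ.isSemialgebraicFunOn_f_apply hs E k)
  have h2 : IsSemialgebraicFunOn ℚ s (fun _ => (2 : ℝ)) := by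
    simpa using isSemialgebraicFunOn_natCast (k := ℚ) (R := ℝ) hs 2
  have hden : IsSemialgebraicFunOn ℚ s (fun x => 2 * (E.e₁ - x k)) :=
    IsSemialgebraicFunOn.mul_holds h2 (IsSemialgebraicFunOn.sub_holds
      (isSemialgebraicFunOn_const_of_isAlgebraic hs E.isAlgebraic_e₁) (isSemialgebraicFunOn_coord hs k))
  have hne : ∀ x ∈ s, 2 * (E.e₁ - x k) ≠ 0 := fun x hx =>
    mul_ne_zero two_ne_zero (sub_ne_zero.2 (fun h => hk x hx h.symm))
  exact (hnum.div hden hne).congr fun x _ => rfl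

end Semialgebraic

/-! ### The determinant of the Jacobian of the reflection move -/

/-- The Jacobian of the reflection move `Φ(x₀, x₁) = (σ x₁, σ x₀)`: the derivative
`(c₁ • pr₁, c₀ • pr₀)` has determinant `−c₁ c₀`. [folklore] -/
theorem det_swapJacobian (c₀ c₁ : ℝ) :
    (ContinuousLinearMap.pi ![c₁ • ContinuousLinearMap.proj (R := ℝ) (φ := fun _ : Fin 2 => ℝ) 1,
        c₀ • ContinuousLinearMap.proj (R := ℝ) (φ := fun _ : Fin 2 => ℝ) 0] :
        (Fin 2 → ℝ) →L[ℝ] (Fin 2 → ℝ)).det = -(c₁ * c₀) := by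
  rw [Summit.KontsevichZagierPeriods.UnfoldedStokes.LegendreCubicFormLine.det_pi_fin_two]
  simp

end Summit.KontsevichZagierPeriods.GenusOneIterated.KummerFamily

end
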